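import Summits.BirchSwinnertonDyer.BirchSwinnertonDyer.Theorems.AlignedTransportAtTwoMainConjectureOfRankZeroBSDAtTwoTwistReadingBounds
import Summits.BirchSwinnertonDyer.BirchSwinnertonDyer.Theorems.AlignedTransportAtTwoMainConjectureOfRankZeroBSDAtTwoTwistReadingRoad
import Literature.NumberTheory.EllipticCurves.BSDSelmerParityDokchitserBaseChangeProofs
import Literature.NumberTheory.EllipticCurves.CyclotomicZpExtensionLayerOneSqrtTwoProofs
import Literature.NumberTheory.EllipticCurves.SelmerCorankHolds
import Literature.NumberTheory.EllipticCurves.IwasawaLeadingTermProofs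
import HarnessLib

/-!
# Route `AlignedTransportAtTwo`, crux C2 `MainConjectureOfRankZeroBSDAtTwo` (stmt-BirchSwinnertonDyer-22298):
# THE SELMER GROUP OF THE FIRST LAYER — `corank_{ℤ₂} Sel_{2^∞}(W/ℚ(√2)) ≤ corank_{ℤ₂} Sel_{2^∞}(W/ℚ) + ord_{T=−2} L₂(W,T)` (the Selmer form of g34's
# layer-one rank bound, `Ш` included); on the `a₂ = +1` road `corank Sel_{2^∞}(W/ℚ(√2)) ≤ 1`, so `rank W(ℚ(√2)) = 1 ⟹ Ш(W/ℚ(√2))[2^∞]` finite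

HONEST FRAMING (cell `bsd-f1-sign2`, WIDTH-5 attached prover seat `bsd-line-att-p5` gen 38 on line `birth` of the lead `bsd-line-att-p2`;
`--supports` stmt-BirchSwinnertonDyer-22298, closes nothing; BSD is NOT proved by any of this; the crux C2, its verdict «blocked-on
`Rank1Residual.GreenbergMuConjectureIrreducible`» and every registered stub are untouched). THEOREMS ONLY — no `def`, no instance, no named fact, no `sorry`.
PRINT binders: `h17` (Kato 17.4 (1)(2) at `2`), `hGZK` where `rank W(ℚ) = 0 ∧ #Ш(W/ℚ) < ∞` is read from `r_an = 0`; the lineage's two-bit-row binders in §3.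
Sequel of `…TwistReading{,Road,Bounds}` — this is the «Ш-side twin at the first layer» of CYCLOTOMIC-LAYERS-II §9 (iii): `ℚ_1 = ℚ(√2)` and
`corank Sel_{2^∞}(W/ℚ_1) = corank Sel_{2^∞}(W/ℚ) + corank Sel_{2^∞}(W⁽²⁾/ℚ)` (Dokchitser–Dokchitser Lemma 4.14, tree theorem `selmerCorank_baseChange_eq_add`, every `p`,
PROVED), so the twist reading IS the layer-one reading on the Selmer side.

* §1 (any elliptic `W/ℚ`, `κ` cyclotomic; NO named fact) `selmerCorank_layer_one_eq_add` — **`corank Sel_{2^∞}(W/ℚ_1) = corank Sel_{2^∞}(W/ℚ) + corank Sel_{2^∞}(W⁽²⁾/ℚ)`**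
  (`√2 ∈ ℚ_1`, `[ℚ_1 : ℚ] = 2`; the binder `[NumberField ℚ_1]` is the tree's `κ.finiteDimensional_layer_holds`, as in `Greenberg1999.SelmerCorankLayerBound`); model form `…_eq_add_of_model`.
* §2 (good ordinary `W` at `2`, PRINT `h17`) ★★ `selmerCorank_layer_one_le_add_orderAtNegTwo` — **`corank_{ℤ₂} Sel_{2^∞}(W/ℚ_1) ≤ corank_{ℤ₂} Sel_{2^∞}(W/ℚ) + ord_{T=−2} L₂(W,T)`**;
  ★ `mordellWeilRank_add_shaCorank_layer_one_le` (the same with `rank W(ℚ_1) + corank Ш(W/ℚ_1)[2^∞]` on the left: Greenberg §1, `corank Sel = rank + corank Ш`, PROVED in tree).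
* §3 THE ROAD: ★★ `selmerCorank_layer_one_le_one_of_road` (`a₂ = +1`: **`corank Sel_{2^∞}(W/ℚ(√2)) ≤ 1`**, PRINT `h17` + `hGZK`), ★★ `finite_sha_layer_one_of_road_of_rank_eq_one`
  (**`rank W(ℚ(√2)) = 1 ⟹ Ш(W/ℚ(√2))[2^∞]` is FINITE**), ★ `selmerCorank_layer_one_eq_one_of_road_of_parity` (`= 1` with the `2`-parity theorem for `W⁽²⁾`: then EXACTLY ONE of
  «`rank W(ℚ(√2)) = 1`, `Ш(W/ℚ(√2))[2^∞]` infinite of corank 1» holds); ★ `selmerCorank_layer_one_le_three_of_road_of_frobeniusTrace_eq_neg_one` (`a₂ = −1`: `≤ 3`);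
  ★ `selmerCorank_layer_one_le_four_of_unitSymbol` (any good-ordinary `W`, unit central symbol, `Sel_{2^∞}(W/ℚ)` finite: `≤ 4`).
* §4 ★★ `lambda_mu_mem_of_road_ord_three_of_selmerCorank_layer_one` — on the `ord₋₂ = 3` row **`corank Sel_{2^∞}(W/ℚ(√2)) ≥ 3 ⟹ (λ, μ) ∈ {(λ₂, 0), (3, 1)}`** (the `j`-bit door of
  `…TwistReadingRoad` in first-layer currency: `Ш(W/ℚ(√2))[2^∞]` of corank `3 − rank W(ℚ(√2))` certifies `j = 3` as well as points do).

References: T. and V. Dokchitser, Ann. of Math. 172 (2010), Lemma 4.14 [DokchitserDokchitserAnnals2010]; T. Dokchitser, *Notes on the parity conjecture* (2013) §4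
[Dokchitser2013ParityNotes]; R. Greenberg, LNM 1716 (1999), §1 pp. 53–57, Thm. 1.9, §3 Lemma 3.1, §4 p. 107 [GreenbergLNM1716]; K. Kato, Astérisque 295 (2004), Thm. 17.4
[Kato2004Asterisque]; K. Matsuno, IJNT 4 (2008), §6 (Prop. 6.4 and its proof: `λ ≡ corank Sel_{2^∞}(E/ℚ(√2))`) [Matsuno2008]; L. Washington, GTM 83, §13.1 [Washington1997].
-/

set_option linter.dupNamespace false
set_option autoImplicit false

noncomputable section

open scoped Classical MatrixGroups ModularForm

namespace Summit.BirchSwinnertonDyer.BirchSwinnertonDyer.Theorems.AlignedTransportAtTwoTwistReadingLayerOne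

open PowerSeries CongruenceSubgroup WeierstrassCurve Literature.NumberTheory.EllipticCurves
  Literature.NumberTheory.EllipticCurves.ModularForms
  Literature.NumberTheory.EllipticCurves.Rank1Residual
  Literature.NumberTheory.EllipticCurves.Rank1Residual.Typed
  Literature.NumberTheory.EllipticCurves.Greenberg1999
  Summit.BirchSwinnertonDyer.Rank1Residual
  Summit.BirchSwinnertonDyer.Rank1Residual.X1.MuLambda
  Summit.BirchSwinnertonDyer.Rank1Residual.F1Sign2
  Summit.BirchSwinnertonDyer.BirchSwinnertonDyer.Theorems.Rank1ResidualX1Defs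
  Summit.BirchSwinnertonDyer.BirchSwinnertonDyer.Theorems.AlignedTransportAtTwoTwoFixedPoints
  Summit.BirchSwinnertonDyer.BirchSwinnertonDyer.Theorems.AlignedTransportAtTwoRoadSecondFixedPoint
  Summit.BirchSwinnertonDyer.BirchSwinnertonDyer.Theorems.AlignedTransportAtTwoTwistReading
  Summit.BirchSwinnertonDyer.BirchSwinnertonDyer.Theorems.AlignedTransportAtTwoTwistReadingRoad
  Summit.BirchSwinnertonDyer.BirchSwinnertonDyer.Theorems.AlignedTransportAtTwoTwistReadingBounds

variable (W : WeierstrassCurve ℚ) [W.IsElliptic]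

/-! ## §1 `corank Sel_{2^∞}(W/ℚ_1) = corank Sel_{2^∞}(W/ℚ) + corank Sel_{2^∞}(W⁽²⁾/ℚ)` — the first layer IS the twist -/

/-- ★ **`corank_{ℤ₂} Sel_{2^∞}(W/ℚ_1) = corank_{ℤ₂} Sel_{2^∞}(W/ℚ) + corank_{ℤ₂} Sel_{2^∞}(W⁽²⁾/ℚ)`** for every elliptic `W/ℚ` and the first layer `ℚ_1` of any cyclotomic
`ℤ₂`-extension `κ` (`√2 ∈ ℚ_1`, tree `IsCyclotomic.exists_sq_eq_two_layer_one`; `[ℚ_1 : ℚ] = 2`; Dokchitser–Dokchitser Lemma 4.14 in the tree's proved form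
`selmerCorank_baseChange_eq_add`). NO named fact. [cite: DokchitserDokchitserAnnals2010, Lemma 4.14] [cite: Washington1997, §13.1] -/
theorem selmerCorank_layer_one_eq_add {κ : ZpExtension ℚ 2} [NumberField (κ.layer 1)] (hκ : κ.IsCyclotomic) :
    (W.baseChange (κ.layer 1)).selmerCorank 2 = W.selmerCorank 2 + (W.quadraticTwist 2).selmerCorank 2 := by
  have h2 : Module.finrank ℚ (κ.layer 1) = 2 := by rw [κ.finrank_layer_holds 1, pow_one]
  obtain ⟨θ, hθ⟩ := hκ.exists_sq_eq_two_layer_one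
  have hc : θ ^ 2 = algebraMap ℚ (κ.layer 1) 2 := by rw [hθ, map_ofNat]
  have hθQ : θ ∉ Set.range (algebraMap ℚ (κ.layer 1)) := by
    rintro ⟨q, hq⟩
    apply AddSelmerTwistTwo.not_exists_rat_sq_eq_two
    refine ⟨q, ?_⟩
    have h : algebraMap ℚ (κ.layer 1) (q ^ 2) = algebraMap ℚ (κ.layer 1) 2 := by rw [map_pow, hq, hc]
    exact (algebraMap ℚ (κ.layer 1)).injective h
  exact selmerCorank_baseChange_eq_add W (κ.layer 1) h2 hθQ hc 2

/-- The same with ANY `ℚ`-model `W₂` of `W⁽²⁾` (`V • W₂ = W^{(2)}`). [cite: DokchitserDokchitserAnnals2010, Lemma 4.14] -/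
theorem selmerCorank_layer_one_eq_add_of_model {κ : ZpExtension ℚ 2} [NumberField (κ.layer 1)] (hκ : κ.IsCyclotomic) (W₂ : WeierstrassCurve ℚ) {V : VariableChange ℚ}
    (hV : V • W₂ = W.quadraticTwist 2) :
    (W.baseChange (κ.layer 1)).selmerCorank 2 = W.selmerCorank 2 + W₂.selmerCorank 2 := by
  rw [selmerCorank_layer_one_eq_add W hκ, selmerCorank_eq_of_variableChange 2 hV]

/-! ## §2 `corank Sel_{2^∞}(W/ℚ_1) ≤ corank Sel_{2^∞}(W/ℚ) + ord_{T=−2} L₂(W,T)` for every good-ordinary `W` -/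

/-- ★★ **THE SELMER FORM OF THE LAYER-ONE BOUND.** `W/ℚ` globally minimal, good ordinary at `2`, `f` a newform of `W` with PRINT `h17`, `G` the integral lift of `L₂(f,α)` with
`ord_{T=−2} G = n`, `κ` cyclotomic. Then **`corank_{ℤ₂} Sel_{2^∞}(W/ℚ_1) ≤ corank_{ℤ₂} Sel_{2^∞}(W/ℚ) + n`** (§1 + `…TwistReading` §3: `corank Sel_{2^∞}(W⁽²⁾/ℚ) ≤ n`). g34's
`mordellWeilRank_layer_one_le_add_orderAtNegTwo` is the Mordell–Weil shadow of this. [cite: Kato2004Asterisque, Thm. 17.4 (1)(2) (p. 273)] [cite: DokchitserDokchitserAnnals2010, Lemma 4.14]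
[cite: GreenbergLNM1716, §3 Lemma 3.1, §4 p. 107] -/
theorem selmerCorank_layer_one_le_add_orderAtNegTwo [W.IsGloballyMinimal] {N : ℕ} [NeZero N] {f : CuspForm (Gamma0 N) 2}
    (h17 : kato_divisibility_allPrimes W 2 (f := f)) (hord : IsOrdinaryAt W 2) (hf : IsNewformOf W f)
    {G : IwasawaAlgebra 2} (hG : iwasawaToPowerSeries 2 G = padicLFunction f (unitRoot W 2 : ℚ_[2])) {n : ℕ}
    (hn : HasOrderAtNegTwo G n) {κ : ZpExtension ℚ 2} [NumberField (κ.layer 1)] (hκ : κ.IsCyclotomic) :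
    (W.baseChange (κ.layer 1)).selmerCorank 2 ≤ W.selmerCorank 2 + n := by
  haveI : (W.quadraticTwist (2 : ℚ)).IsElliptic := W.isElliptic_quadraticTwist two_ne_zero
  rw [selmerCorank_layer_one_eq_add W hκ]
  have h := (selmerCorank_twist_le_orderAtNegTwo W (W.quadraticTwist 2) (V := 1) (one_smul _ _) h17 hord hf hG hn).1
  omega

/-- ★ **`rank W(ℚ_1) + corank Ш(W/ℚ_1)[2^∞] ≤ corank Sel_{2^∞}(W/ℚ) + ord_{T=−2} L₂(W,T)`** (the tree's proved identity `corank Sel = rank + corank Ш` over the number field `ℚ_1`).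
[cite: GreenbergLNM1716, §1 pp. 53–57] [cite: Kato2004Asterisque, Thm. 17.4 (1)(2) (p. 273)] -/
theorem mordellWeilRank_add_shaCorank_layer_one_le [W.IsGloballyMinimal] {N : ℕ} [NeZero N] {f : CuspForm (Gamma0 N) 2}
    (h17 : kato_divisibility_allPrimes W 2 (f := f)) (hord : IsOrdinaryAt W 2) (hf : IsNewformOf W f)
    {G : IwasawaAlgebra 2} (hG : iwasawaToPowerSeries 2 G = padicLFunction f (unitRoot W 2 : ℚ_[2])) {n : ℕ}
    (hn : HasOrderAtNegTwo G n) {κ : ZpExtension ℚ 2} [NumberField (κ.layer 1)] (hκ : κ.IsCyclotomic) :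
    (W.baseChange (κ.layer 1)).mordellWeilRank + (W.baseChange (κ.layer 1)).shaCorank 2 ≤ W.selmerCorank 2 + n := by
  haveI : (W.baseChange (κ.layer 1)).IsElliptic := by rw [baseChange]; infer_instance
  rw [← (W.baseChange (κ.layer 1)).selmerCorank_eq_mordellWeilRank_add_holds 2]
  exact selmerCorank_layer_one_le_add_orderAtNegTwo W h17 hord hf hG hn hκ

/-! ## §3 The road: `corank Sel_{2^∞}(W/ℚ(√2)) ≤ 1` on `a₂ = +1`; `rank W(ℚ(√2)) = 1 ⟹ Ш(W/ℚ(√2))[2^∞]` finite -/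

/-- **`r_an(W) = 0 ⟹ corank_{ℤ₂} Sel_{2^∞}(W/ℚ) = 0`** (PRINT `hGZK`: `rank W(ℚ) = 0` and `Ш(W/ℚ)` finite; the proved identity `corank Sel = rank + corank Ш`).
[cite: GreenbergLNM1716, §1 pp. 53–57] -/
theorem selmerCorank_eq_zero_of_analyticRank_eq_zero (hGZK : rank_eq_analyticRank_of_analyticRank_le_one) (hr : W.analyticRank = 0) :
    W.selmerCorank 2 = 0 := by
  obtain ⟨hrk, hfin⟩ := hGZK W (by rw [hr]; exact zero_le_one)
  haveI : Finite W.sha := hfin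
  rw [W.selmerCorank_eq_mordellWeilRank_add_holds 2, hrk, hr, W.shaCorank_eq_zero_of_finite 2]

/-- ★★ **THE `a₂ = +1` ROAD: `corank_{ℤ₂} Sel_{2^∞}(W/ℚ(√2)) ≤ 1`.** `W` globally minimal, good ordinary at `2`, `a₂ = +1`, `∏ c_v` odd, `Δ_min ≡ 3, 5 (mod 8)`, `r_an(W) = 0`, `f` its newform at
level `N_W` with `‖[0]⁺_f‖₂ = 1`; PRINT `h17`, `hGZK`; `κ` cyclotomic. Hence `rank W(ℚ(√2)) + corank Ш(W/ℚ(√2))[2^∞] ≤ 1`. [cite: Kato2004Asterisque, Thm. 17.4 (1)(2) (p. 273)]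
[cite: DokchitserDokchitserAnnals2010, Lemma 4.14] [cite: GreenbergLNM1716, §1 pp. 53–57, §3 Lemma 3.1, §4 p. 107] -/
theorem selmerCorank_layer_one_le_one_of_road [W.IsGloballyMinimal] [NeZero (W.conductorNorm ℤ)] {f : CuspForm (Gamma0 (W.conductorNorm ℤ)) 2}
    (h17 : kato_divisibility_allPrimes W 2 (f := f)) (hGZK : rank_eq_analyticRank_of_analyticRank_le_one) (hord : IsOrdinaryAt W 2)
    (hf : IsNewformOf W f) (ha : W.frobeniusTrace 2 = 1) (hodd : Odd W.tamagawaProduct)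
    (hΔ : minimalDiscriminantInt W % 8 = 3 ∨ minimalDiscriminantInt W % 8 = 5) (hr : W.analyticRank = 0)
    {G : IwasawaAlgebra 2} (hG : iwasawaToPowerSeries 2 G = padicLFunction f (unitRoot W 2 : ℚ_[2]))
    (hsym : ‖(ratPlusSymbol f 0 : ℚ_[2])‖ = 1) {κ : ZpExtension ℚ 2} [NumberField (κ.layer 1)] (hκ : κ.IsCyclotomic) :
    (W.baseChange (κ.layer 1)).selmerCorank 2 ≤ 1 ∧
      (W.baseChange (κ.layer 1)).mordellWeilRank + (W.baseChange (κ.layer 1)).shaCorank 2 ≤ 1 := by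
  haveI : (W.quadraticTwist (2 : ℚ)).IsElliptic := W.isElliptic_quadraticTwist two_ne_zero
  haveI : (W.baseChange (κ.layer 1)).IsElliptic := by rw [baseChange]; infer_instance
  have h0 := selmerCorank_eq_zero_of_analyticRank_eq_zero W hGZK hr
  have h1 := (selmerCorank_twist_le_one_of_road W (W.quadraticTwist 2) (V := 1) (one_smul _ _) h17 hord hf ha hodd hΔ hr hG hsym).1
  have hle : (W.baseChange (κ.layer 1)).selmerCorank 2 ≤ 1 := by
    rw [selmerCorank_layer_one_eq_add W hκ, h0, zero_add]; exact h1
  exact ⟨hle, by rw [← (W.baseChange (κ.layer 1)).selmerCorank_eq_mordellWeilRank_add_holds 2]; exact hle⟩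

/-- ★★ **`rank W(ℚ(√2)) = 1 ⟹ Ш(W/ℚ(√2))[2^∞]` IS FINITE on the `a₂ = +1` road** (hypotheses of `selmerCorank_layer_one_le_one_of_road`): the point of infinite order of the
twist exhausts the layer-one Selmer corank. [cite: Kato2004Asterisque, Thm. 17.4 (1)(2) (p. 273)] [cite: GreenbergLNM1716, §1 pp. 53–57, §4 p. 107] -/
theorem finite_sha_layer_one_of_road_of_rank_eq_one [W.IsGloballyMinimal] [NeZero (W.conductorNorm ℤ)] {f : CuspForm (Gamma0 (W.conductorNorm ℤ)) 2}
    (h17 : kato_divisibility_allPrimes W 2 (f := f)) (hGZK : rank_eq_analyticRank_of_analyticRank_le_one) (hord : IsOrdinaryAt W 2)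
    (hf : IsNewformOf W f) (ha : W.frobeniusTrace 2 = 1) (hodd : Odd W.tamagawaProduct)
    (hΔ : minimalDiscriminantInt W % 8 = 3 ∨ minimalDiscriminantInt W % 8 = 5) (hr : W.analyticRank = 0)
    {G : IwasawaAlgebra 2} (hG : iwasawaToPowerSeries 2 G = padicLFunction f (unitRoot W 2 : ℚ_[2]))
    (hsym : ‖(ratPlusSymbol f 0 : ℚ_[2])‖ = 1) {κ : ZpExtension ℚ 2} [NumberField (κ.layer 1)] (hκ : κ.IsCyclotomic)
    (hrk : (W.baseChange (κ.layer 1)).mordellWeilRank = 1) :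
    Finite (AddCommGroup.primaryComponent (W.baseChange (κ.layer 1)).sha 2) := by
  haveI : (W.baseChange (κ.layer 1)).IsElliptic := by rw [baseChange]; infer_instance
  rw [finite_primaryComponent_sha_iff_shaCorank_eq_zero]
  have h := (selmerCorank_layer_one_le_one_of_road W h17 hGZK hord hf ha hodd hΔ hr hG hsym hκ).2
  omega

/-- ★ **`corank_{ℤ₂} Sel_{2^∞}(W/ℚ(√2)) = 1` EXACTLY** on the `a₂ = +1` road, given the PRINT `2`-parity theorem for a model `W₂` of the twist (`p_parity W₂ 2`) and its root number
`w(W₂) = −1` (g32 `…OffStratumChi8Twist`): hence EXACTLY ONE of «`rank W(ℚ(√2)) = 1` (then `Ш(W/ℚ(√2))[2^∞]` finite)», «`rank W(ℚ(√2)) = 0` and `Ш(W/ℚ(√2))[2^∞]` has corank `1`».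
[cite: DokchitserDokchitserAnnals2010, Thm. 1.4 and Lemma 4.14] [cite: Kato2004Asterisque, Thm. 17.4 (1)(2) (p. 273)] -/
theorem selmerCorank_layer_one_eq_one_of_road_of_parity [W.IsGloballyMinimal] [NeZero (W.conductorNorm ℤ)]
    {f : CuspForm (Gamma0 (W.conductorNorm ℤ)) 2} (W₂ : WeierstrassCurve ℚ) [W₂.IsElliptic] {V : VariableChange ℚ} (hV : V • W₂ = W.quadraticTwist 2)
    (h17 : kato_divisibility_allPrimes W 2 (f := f)) (hDD : p_parity W₂ 2) (hw : W₂.rootNumber = -1)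
    (hGZK : rank_eq_analyticRank_of_analyticRank_le_one) (hord : IsOrdinaryAt W 2)
    (hf : IsNewformOf W f) (ha : W.frobeniusTrace 2 = 1) (hodd : Odd W.tamagawaProduct)
    (hΔ : minimalDiscriminantInt W % 8 = 3 ∨ minimalDiscriminantInt W % 8 = 5) (hr : W.analyticRank = 0)
    {G : IwasawaAlgebra 2} (hG : iwasawaToPowerSeries 2 G = padicLFunction f (unitRoot W 2 : ℚ_[2]))
    (hsym : ‖(ratPlusSymbol f 0 : ℚ_[2])‖ = 1) {κ : ZpExtension ℚ 2} [NumberField (κ.layer 1)] (hκ : κ.IsCyclotomic) :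
    (W.baseChange (κ.layer 1)).selmerCorank 2 = 1 ∧
      (W.baseChange (κ.layer 1)).mordellWeilRank + (W.baseChange (κ.layer 1)).shaCorank 2 = 1 := by
  haveI : (W.baseChange (κ.layer 1)).IsElliptic := by rw [baseChange]; infer_instance
  have h1 := selmerCorank_twist_eq_one_of_road_of_parity W W₂ hV h17 hDD hw hord hf ha hodd hΔ hr hG hsym
  have h0 := selmerCorank_eq_zero_of_analyticRank_eq_zero W hGZK hr
  have heq : (W.baseChange (κ.layer 1)).selmerCorank 2 = 1 := by
    rw [selmerCorank_layer_one_eq_add_of_model W hκ W₂ hV, h0, h1]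
  exact ⟨heq, by rw [← (W.baseChange (κ.layer 1)).selmerCorank_eq_mordellWeilRank_add_holds 2]; exact heq⟩

/-- ★ **The `a₂ = −1` road: `corank_{ℤ₂} Sel_{2^∞}(W/ℚ(√2)) ≤ 3`** (`ord₋₂ L₂ ∈ {1, 3}`, `…TwistReadingBounds`), PRINT `h17` + `hGZK`.
[cite: Kato2004Asterisque, Thm. 17.4 (1)(2) (p. 273)] [cite: DokchitserDokchitserAnnals2010, Lemma 4.14] -/
theorem selmerCorank_layer_one_le_three_of_road_of_frobeniusTrace_eq_neg_one [W.IsGloballyMinimal] [NeZero (W.conductorNorm ℤ)]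
    {f : CuspForm (Gamma0 (W.conductorNorm ℤ)) 2}
    (h17 : kato_divisibility_allPrimes W 2 (f := f)) (hGZK : rank_eq_analyticRank_of_analyticRank_le_one) (hord : IsOrdinaryAt W 2)
    (hf : IsNewformOf W f) (ha : W.frobeniusTrace 2 = -1) (hodd : Odd W.tamagawaProduct)
    (hΔ : minimalDiscriminantInt W % 8 = 3 ∨ minimalDiscriminantInt W % 8 = 5) (hr : W.analyticRank = 0)
    {G : IwasawaAlgebra 2} (hG : iwasawaToPowerSeries 2 G = padicLFunction f (unitRoot W 2 : ℚ_[2]))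
    (hsym : ‖(ratPlusSymbol f 0 : ℚ_[2])‖ = 1) {κ : ZpExtension ℚ 2} [NumberField (κ.layer 1)] (hκ : κ.IsCyclotomic) :
    (W.baseChange (κ.layer 1)).selmerCorank 2 ≤ 3 ∧
      (W.baseChange (κ.layer 1)).mordellWeilRank + (W.baseChange (κ.layer 1)).shaCorank 2 ≤ 3 := by
  haveI : (W.quadraticTwist (2 : ℚ)).IsElliptic := W.isElliptic_quadraticTwist two_ne_zero
  haveI : (W.baseChange (κ.layer 1)).IsElliptic := by rw [baseChange]; infer_instance
  have h0 := selmerCorank_eq_zero_of_analyticRank_eq_zero W hGZK hr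
  have h3 := (selmerCorank_twist_le_three_of_road_of_frobeniusTrace_eq_neg_one W (W.quadraticTwist 2) (V := 1) (one_smul _ _) h17 hord hf ha
    hodd hΔ hr hG hsym).1
  have hle : (W.baseChange (κ.layer 1)).selmerCorank 2 ≤ 3 := by
    rw [selmerCorank_layer_one_eq_add W hκ, h0, zero_add]; exact h3
  exact ⟨hle, by rw [← (W.baseChange (κ.layer 1)).selmerCorank_eq_mordellWeilRank_add_holds 2]; exact hle⟩

/-- ★ **Unit central symbol, any good-ordinary `W` with `r_an(W) = 0`: `corank_{ℤ₂} Sel_{2^∞}(W/ℚ(√2)) ≤ 4`** (`≤ 2·ord₂ #Ẽ(𝔽₂)`; `…TwistReadingBounds` §1). PRINT `h17` + `hGZK`.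
[cite: Kato2004Asterisque, Thm. 17.4 (1)(2) (p. 273)] [cite: MazurTateTeitelbaum1986Invent, §I.14] -/
theorem selmerCorank_layer_one_le_four_of_unitSymbol [W.IsGloballyMinimal] [NeZero (W.conductorNorm ℤ)] {f : CuspForm (Gamma0 (W.conductorNorm ℤ)) 2}
    (h17 : kato_divisibility_allPrimes W 2 (f := f)) (hGZK : rank_eq_analyticRank_of_analyticRank_le_one) (hord : IsOrdinaryAt W 2)
    (hf : IsNewformOf W f) (hr : W.analyticRank = 0)
    {G : IwasawaAlgebra 2} (hG : iwasawaToPowerSeries 2 G = padicLFunction f (unitRoot W 2 : ℚ_[2]))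
    (hsym : ‖(ratPlusSymbol f 0 : ℚ_[2])‖ = 1) {κ : ZpExtension ℚ 2} [NumberField (κ.layer 1)] (hκ : κ.IsCyclotomic) :
    (W.baseChange (κ.layer 1)).selmerCorank 2 ≤ 4 := by
  haveI : (W.quadraticTwist (2 : ℚ)).IsElliptic := W.isElliptic_quadraticTwist two_ne_zero
  have h0 := selmerCorank_eq_zero_of_analyticRank_eq_zero W hGZK hr
  have h4 := (selmerCorank_twist_le_four_of_unitSymbol W (W.quadraticTwist 2) (V := 1) (one_smul _ _) h17 hord hf hG hsym).1
  rw [selmerCorank_layer_one_eq_add W hκ, h0, zero_add]; exact h4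

/-! ## §4 The `j`-bit door in first-layer currency: `corank Sel_{2^∞}(W/ℚ(√2)) ≥ 3 ⟹ j = 3` on the `ord₋₂ = 3` row -/

/-- ★★ **`corank_{ℤ₂} Sel_{2^∞}(W/ℚ(√2)) ≥ 3 ⟹ (λ(X), μ(X)) ∈ {(λ₂, 0), (3, 1)}`** on the `a₂ = −1`, `ord₋₂ L₂ = 3` row (hypotheses of
`…TwistReadingRoad.lambda_mu_mem_of_road_ord_three_of_selmerCorank_twist`; here the certificate is the LAYER-ONE Selmer corank — three independent points over `ℚ(√2)`, or fewer points
and an infinite `Ш(W/ℚ(√2))[2^∞]` of the complementary corank — since `corank Sel(W/ℚ_1) = corank Sel(W⁽²⁾/ℚ)` when `r_an(W) = 0`). [cite: Kato2004Asterisque, Thm. 17.4 (1)(2) (p. 273)]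
[cite: DokchitserDokchitserAnnals2010, Lemma 4.14] [cite: GreenbergLNM1716, §3 Lemma 3.1, §4 p. 107, §5 pp. 176–178] -/
theorem lambda_mu_mem_of_road_ord_three_of_selmerCorank_layer_one [W.IsGloballyMinimal] [NeZero (W.conductorNorm ℤ)]
    {f : CuspForm (Gamma0 (W.conductorNorm ℤ)) 2}
    (h17 : kato_divisibility_allPrimes W 2 (f := f)) (h64 : matsuno2008_prop64_lambda_parity_two)
    (hGr : Greenberg1999.thm41_charValue_rankZero_anyPrime) (hper : realPeriodRat_eq_unit_mul_plusPeriod_two)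
    (hGZK : rank_eq_analyticRank_of_analyticRank_le_one) (hord : IsOrdinaryAt W 2)
    (ht : ∀ x : ℚ, ¬ HasRationalTwoTorsionX W x) (hr : W.analyticRank = 0) (hbsd : BSDp W 2) (hf : IsNewformOf W f)
    (ha : W.frobeniusTrace 2 = -1) (hodd : Odd W.tamagawaProduct)
    (hΔ : minimalDiscriminantInt W % 8 = 3 ∨ minimalDiscriminantInt W % 8 = 5)
    {G : IwasawaAlgebra 2} (hG : iwasawaToPowerSeries 2 G = padicLFunction f (unitRoot W 2 : ℚ_[2])) (hred : red G ≠ 0)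
    (h3 : HasOrderAtNegTwo G 3) (hsym : ‖(ratPlusSymbol f 0 : ℚ_[2])‖ = 1)
    {κ : ZpExtension ℚ 2} [NumberField (κ.layer 1)] {γ : Field.absoluteGaloisGroup ℚ} (hκ : κ.IsCyclotomic)
    (hγ : κ.IsTopGenerator γ) (hγ' : IsCyclotomicVariable 2 γ) (D : W.SelmerDualData κ γ) (hs : 3 ≤ (W.baseChange (κ.layer 1)).selmerCorank 2) :
    (D.lambda = lam G ∧ D.mu = 0) ∨ (D.lambda = 3 ∧ D.mu = 1) := by
  haveI : (W.quadraticTwist (2 : ℚ)).IsElliptic := W.isElliptic_quadraticTwist two_ne_zero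
  have h0 := selmerCorank_eq_zero_of_analyticRank_eq_zero W hGZK hr
  have hs' : 3 ≤ (W.quadraticTwist 2).selmerCorank 2 := by
    rw [selmerCorank_layer_one_eq_add W hκ, h0, zero_add] at hs; exact hs
  exact lambda_mu_mem_of_road_ord_three_of_selmerCorank_twist W (W.quadraticTwist 2) (V := 1) (one_smul _ _) h17 h64 hGr hper hGZK hord ht hr
    hbsd hf ha hodd hΔ hG hred h3 hsym hs' hκ hγ hγ' D

end Summit.BirchSwinnertonDyer.BirchSwinnertonDyer.Theorems.AlignedTransportAtTwoTwistReadingLayerOne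

end
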